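/-
Copyright: the b2b-balaban T⁴-continuum CRUX team, row NE7b OWNER lineage `t4-ne7b-p1` (gen 126). Project licence.
-/
import Summits.QuantumFields.BalabanUV.T4Continuum.Spine.NE7b.SupZdPerturbedOneStop
import Summits.QuantumFields.BalabanUV.T4Continuum.Spine.NE7b.SupZdCouplingTransferSolvability

/-!
# THE ROAD'S BASE PACKAGE AT ITS OWN COUPLING: for `d ≥ 3`, `a > 0`, `λ < min(2,a)`, `Λ ≥ 0`, ten constants from `(d, a, λ, Λ)` such that
# for every mesh `n`, potential `−λ ≤ V ≤ Λ`, rates and a kernel `K` small against them, the `H + K` column at coupling `a` has THE PACKAGE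
# that (264)∕(268) propagate along the couplings — (P1) block columns with profile `2C_PK_{δ₀−μ}` at rate `μ`, (P2) a solution operator
# `G_K ∈ L(ℓ^∞(ℤ^d))` with `‖G_K‖ ≤ 2C_G`, (P3) uniqueness of bounded solutions, (P4) a two-sided decaying inverse `N_K` of the coarse matrix —
# read off (246)'s one-stop ((A), (C)) and (213)'s inverse operator, in exactly the shape (264) consumes; so (268) applies BY NAME at the
# road's coupling: the composed tower of (255) carries the package for every mesh beyond the two thresholds (row NE7b, node U5c;
# (213)∕(246) BY NAME; [folklore])

Cell `pub-balaban`, sub-cell `t4`, spine estimate NE7b (`T4WeightBudget.RelWeightBound`; the cell's OWN estimate — NOT PRINTED in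
[Bałaban 1983–89], NOT PROVED).  Crux-route work under `Spine/NE7b/` by the row OWNER (`t4-ne7b-p1` gen 126, file (269)) under FREEZE
(0)'s crux-prover clause, on § [NE7bP1-G125-HANDOFF] NEXT (3)(a); NOTHING of Bałaban's is named as a Lean object, valued or asserted; no
`T4Continuum/Support` leaf typed; no `def`, no notation; zero `sorry`.  Imports (BY NAME): the OWNER's (246) `…SupZdPerturbedOneStop`
(`zd_perturbed_one_stop`), (263) `…SupZdCouplingTransferSolvability` (import closure: (213) `zd_perturbed_inverse_clm`, (58)
`abs_apply_le_norm`, the `lp` API).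

WHY (located).  (264) takes the package at the reference coupling as four displayed inputs; at the road's own coupling they are
theorems of the column, but spread over (216)∕(222)∕(237)∕(246) (columns, inverse, uniqueness) and (213) (the `ℓ^∞` solution operator).
This file quotes (246) and (213) once each and re-emits (P1)–(P4) verbatim in (264)'s shape — (P3) from (213)'s uniqueness clause read on
bounded functions (a bounded source is an `ℓ^∞` element) — so that the successor's window files start from ONE `obtain`.

WHAT IS PROVED ([folklore]): **`road_base_package`** (THE END: `∃ C₀ C_P δ₀ c₁ δ₁ C₀′ C_P′ δ₀′ Λ_T C_G > 0`, for all data as in (246) plus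
(213)'s smallness `εK_γC_G ≤ 1∕2`: `∃ Ψ G N` with (P1)–(P4) at coupling `a`); §2 toy.

HONEST (what this is NOT).  Packaging by name — no new estimate; `d ≥ 3` and the road's class only ((246)∕(213)); the smallness of `K` is
against the reference constants ONCE (the point of the window files); scalar skeleton ((A3), NC-NE7b-α UNRULED); nothing of the torus;
nothing of the covariant propagators of [B4]–[B6]; nothing of Bałaban's asserted.  BY-NAME EFFECT ON THE WALL: NONE.  NE7b NOT PRINTED ∕
NOT PROVED; spine PROVED 0∕9; rung (B)+1 — the programme's measures remain FINITE-torus statements; NOT the mass gap, NOT Clay.  HONEST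
DEPENDENCY: continuum YM on T⁴ ⇐ BetaPertH ∧ nine spine estimates (0∕9 proved); BetaPertH ⇐ (D1) ∧ (D4) ∧ CAP+tail; G-an2-4 gates asym,
D1 and NE2∕3∕4.
-/

set_option autoImplicit false

noncomputable section

namespace Summit.QuantumFields.BalabanUV.T4Continuum.NE7b.SupZdCouplingWindowBase

open Real Filter Topology
open scoped ENNReal
open Literature.MathematicalPhysics.QuantumFieldTheory.Balaban1983to89
open B6QGQLower276 (X e blk B mem_B sum_B_const)
open OneShotChartSupOperator (abs_apply_le_norm)
open SupZdPerturbedOperator (zd_perturbed_inverse_clm)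
open SupZdPerturbedOneStop (zd_perturbed_one_stop)

variable {d : ℕ}

/-! ## §1. THE END: the package at the road's coupling -/

/-- **HEADLINE — THE ROAD'S BASE PACKAGE.**  `d ≥ 3`, `a > 0`, `λ < min(2,a)`, `Λ ≥ 0` ⟹ ten positive constants such that for all `n`,
`−λ ≤ V ≤ Λ`, `ε, γ, μ, ν` with (246)'s six and (213)'s one smallness conditions, and every kernel of the class: `∃ Ψ G N` — (P1) the
perturbed block columns with profile `2C_PK_{δ₀−μ}e^{−μ|blk p − c|₁}` and their equations at coupling `a`, (P2) `G ∈ L(ℓ^∞)` with `‖G‖ ≤ 2C_G`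
solving the equation, (P3) uniqueness of bounded solutions, (P4) `N` with profile `2c₁e^{νd}K_{δ₁−ν}e^{−ν|b−c|₁}`, `T_aN = 1 = NT_a`. [folklore] -/
theorem road_base_package (hd : 3 ≤ d) (a : ℝ) (ha : 0 < a) {lam Lam : ℝ} (hlam : lam < min 2 a) (hLam : 0 ≤ Lam) :
    ∃ C₀ CP δ₀ c₁ δ₁ C₀' CP' δ₀' ΛT CG : ℝ, 0 < C₀ ∧ 0 < CP ∧ 0 < δ₀ ∧ 0 < c₁ ∧ 0 < δ₁ ∧ 0 < C₀' ∧ 0 < CP' ∧ 0 < δ₀' ∧ 0 < ΛT ∧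
      0 < CG ∧
    ∀ (n : ℕ) (V : X d → ℝ), (∀ p, -lam ≤ V p) → (∀ p, V p ≤ Lam) →
    ∀ (ε γ μ ν : ℝ), 0 ≤ ε → 0 < μ → μ < δ₀ → μ < γ → 0 < ν → ν < μ → ν < δ₁ →
      ε * (2 * (1 - exp (-γ))⁻¹) ^ d * C₀ ≤ 1 / 2 →
      (CP * (2 * (1 - exp (-(δ₀ - μ)))⁻¹) ^ d) * (ε * exp (μ * d) * (2 * (1 - exp (-(γ - μ)))⁻¹) ^ d) ≤ 1 / 2 →
      (c₁ * exp (ν * d) * (2 * (1 - exp (-(δ₁ - ν)))⁻¹) ^ d)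
        * ((4 * (CP * (2 * (1 - exp (-(δ₀ - μ)))⁻¹) ^ d)
            * ((CP * (2 * (1 - exp (-(δ₀ - μ)))⁻¹) ^ d) * (ε * exp (μ * d) * (2 * (1 - exp (-(γ - μ)))⁻¹) ^ d)))
          * exp (ν * d) * (2 * (1 - exp (-(μ - ν)))⁻¹) ^ d) ≤ 1 / 2 →
      -- the Green's function's constants ((224)): range and two smallness conditions
      μ < δ₀' → ε * (2 * (1 - exp (-γ))⁻¹) ^ d * C₀' ≤ 1 / 2 →
      (CP' * (2 * (1 - exp (-(δ₀' - μ)))⁻¹) ^ d) * (ε * exp (μ * d) * (2 * (1 - exp (-(γ - μ)))⁻¹) ^ d) ≤ 1 / 2 →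
      -- (213)'s smallness for the solution operator
      ε * (2 * (1 - exp (-γ))⁻¹) ^ d * CG ≤ 1 / 2 →
    ∀ (K : X d → X d → ℝ), (∀ p q, |K p q| ≤ ε * exp (-(γ * ∑ i, (((p i - q i).natAbs : ℕ) : ℝ)))) →
    ∃ (Ψ : X d → X d → ℝ) (G : lp (fun _ : X d => ℝ) ∞ →L[ℝ] lp (fun _ : X d => ℝ) ∞) (N : X d → X d → ℝ),
      -- (P1) the columns at `a`
      (∀ c p, |Ψ c p| ≤ 2 * (CP * (2 * (1 - exp (-(δ₀ - μ)))⁻¹) ^ d) * exp (-(μ * ∑ i, (((blk n p i - c i).natAbs : ℕ) : ℝ)))) ∧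
      (∀ c p, ((n : ℝ) + 1) ^ 2 * ∑ μ', (2 * Ψ c p - Ψ c (p + e μ') - Ψ c (p - e μ'))
        + a / ((n : ℝ) + 1) ^ d * ∑ q ∈ B n (blk n p), Ψ c q + V p * Ψ c p + ∑' q : X d, K p q * Ψ c q
          = if blk n p = c then 1 else 0) ∧
      -- (P2) the solution operator at `a`
      ‖G‖ ≤ 2 * CG ∧
      (∀ (f : lp (fun _ : X d => ℝ) ∞) (p : X d),
        ((n : ℝ) + 1) ^ 2 * ∑ μ', (2 * G f p - G f (p + e μ') - G f (p - e μ'))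
          + a / ((n : ℝ) + 1) ^ d * ∑ q ∈ B n (blk n p), G f q + V p * G f p + ∑' q : X d, K p q * G f q = f p) ∧
      -- (P3) uniqueness of bounded solutions at `a`
      (∀ (f : X d → ℝ) (Mf : ℝ), (∀ p, |f p| ≤ Mf) → ∀ (u v : X d → ℝ) (Bu Bv : ℝ), (∀ p, |u p| ≤ Bu) → (∀ p, |v p| ≤ Bv) →
        (∀ p, ((n : ℝ) + 1) ^ 2 * ∑ μ', (2 * u p - u (p + e μ') - u (p - e μ'))
          + a / ((n : ℝ) + 1) ^ d * ∑ q ∈ B n (blk n p), u q + V p * u p + ∑' q : X d, K p q * u q = f p) →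
        (∀ p, ((n : ℝ) + 1) ^ 2 * ∑ μ', (2 * v p - v (p + e μ') - v (p - e μ'))
          + a / ((n : ℝ) + 1) ^ d * ∑ q ∈ B n (blk n p), v q + V p * v p + ∑' q : X d, K p q * v q = f p) →
        ∀ p, u p = v p) ∧
      -- (P4) the two-sided decaying inverse of the coarse matrix at `a`
      (∀ b c, |N b c| ≤ 2 * (c₁ * exp (ν * d) * (2 * (1 - exp (-(δ₁ - ν)))⁻¹) ^ d) * exp (-(ν * ∑ i, (((b i - c i).natAbs : ℕ) : ℝ)))) ∧
      (∀ b c', ∑' c : X d, ((((n : ℝ) + 1) ^ d)⁻¹ * ∑ q ∈ B n b, Ψ c q) * N c c' = if b = c' then 1 else 0) ∧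
      (∀ c b, ∑' b' : X d, N c b' * ((((n : ℝ) + 1) ^ d)⁻¹ * ∑ q ∈ B n b', Ψ b q) = if c = b then 1 else 0) := by
  classical
  obtain ⟨C₀, CP, δ₀, c₁, δ₁, C₀', CP', δ₀', ΛT, hC₀, hCP, hδ₀, hc₁, hδ₁, hC₀', hCP', hδ₀', hΛT, H246⟩ :=
    zd_perturbed_one_stop (d := d) hd a ha hlam hLam
  obtain ⟨CG, hCG, H213⟩ := zd_perturbed_inverse_clm (d := d) hd a ha hlam hLam
  refine ⟨C₀, CP, δ₀, c₁, δ₁, C₀', CP', δ₀', ΛT, CG, hC₀, hCP, hδ₀, hc₁, hδ₁, hC₀', hCP', hδ₀', hΛT, hCG, ?_⟩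
  intro n V hV hV' ε γ μ ν hε hμ hμδ hμγ hν hνμ hνδ hsmall1 hsmall2 hsmall3 hμδe hsmall1e hsmall2e hsmallG K hK
  have hγ : 0 < γ := hμ.trans hμγ
  obtain ⟨Ψ, ΨK, M, N, -, -, hA3, hA4, -, -, -, -, -, -, -, hC1, hC2, hC3, -, -, -, -, -, -, -⟩ :=
    H246 n V hV hV' ε γ μ ν hε hμ hμδ hμγ hν hνμ hνδ hsmall1 hsmall2 hsmall3 hμδe hsmall1e hsmall2e K hK
  obtain ⟨GK, hGn, hGeq, hGuniq⟩ := H213 n V hV hV' ε γ hε hγ hsmallG K hK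
  refine ⟨ΨK, GK, N, hA4, hA3, hGn, hGeq, ?_, hC1, fun b c' => (hC2 b c').2, fun c b => (hC3 c b).2⟩
  -- (P3): two bounded solutions are both `G_K` of the source read as an `ℓ^∞` element
  intro f Mf hf u v Bu Bv hub hvb hu hv p
  have hmem : Memℓp f ∞ := memℓp_infty ⟨Mf, by rintro _ ⟨q, rfl⟩; show ‖f q‖ ≤ Mf; rw [Real.norm_eq_abs]; exact hf q⟩
  obtain ⟨F, hF⟩ : ∃ F : lp (fun _ : X d => ℝ) ∞, ∀ q, F q = f q := ⟨⟨f, hmem⟩, fun _ => rfl⟩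
  have hu' := hGuniq F u Bu hub (fun q => (hu q).trans (hF q).symm)
  have hv' := hGuniq F v Bv hvb (fun q => (hv q).trans (hF q).symm)
  rw [hu' p, hv' p]

/-! ## §2. Toy -/

/-- Toy (`d = 3`, `a = 1`, `λ = 0`, `Λ = 1`): the ten constants of the base package exist. -/
example : ∃ C₀ CP δ₀ c₁ δ₁ C₀' CP' δ₀' ΛT CG : ℝ, 0 < C₀ ∧ 0 < CP ∧ 0 < δ₀ ∧ 0 < c₁ ∧ 0 < δ₁ ∧ 0 < C₀' ∧ 0 < CP' ∧ 0 < δ₀' ∧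
    0 < ΛT ∧ 0 < CG :=
  let ⟨C₀, CP, δ₀, c₁, δ₁, C₀', CP', δ₀', ΛT, CG, h1, h2, h3, h4, h5, h6, h7, h8, h9, h10, _⟩ :=
    road_base_package (d := 3) le_rfl 1 one_pos (lam := 0) (Lam := 1)
      (by rw [min_eq_right (by norm_num : (1 : ℝ) ≤ 2)]; norm_num) zero_le_one
  ⟨C₀, CP, δ₀, c₁, δ₁, C₀', CP', δ₀', ΛT, CG, h1, h2, h3, h4, h5, h6, h7, h8, h9, h10⟩

end Summit.QuantumFields.BalabanUV.T4Continuum.NE7b.SupZdCouplingWindowBase
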